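import Mathlib
import Literature.Computability.AlgebraicComplexity.BorderApolarityLimits

/-!
# Borel normal form, part 1: limits of one-parameter families of subspaces of a polynomial ring

Support file for `stub_borelNormalForm` (line `symbolic-square-border-apolarity` of
`FidelityWitnesses.FidelityGapThreeSeventeen`): the elementary replacement of the Borel fixed point
theorem (CHL 2023 §2.4 "we may assume `I` is Borel fixed"; BB 2021 Thm 4.3).  A one-parameter family of
subspaces `W(ε) = g(1/ε) · W` of `P = K[x_σ]` (`g(s) = exp(s D)` a unipotent root subgroup, or a torus
`λ(s)`) is encoded by its LATTICE of polynomial families `F(ε) ∈ P[ε]` lying in `W(ε)`, tested through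
a quasi-inverse operator `Hb` (`Hb ∘ g(1/ε) = ε^a`): `F ∈ lat ⇔ Hb F ∈ W[ε]`.  The LIMIT
`lim W = {F(0) : F ∈ lat}` is the limit point of the curve in the Grassmannian.  Here: families
`famOf S = S[ε]`, coefficientwise maps `cw`, `lat Hb S W`, `limW Hb S W`, and the passage of CLOSED
conditions to the limit (products, sups, fixed subspaces, inherited stability).  General linear
algebra, PROVED; no dependency on the line's vocabulary.
Refs: Conner–Harper–Landsberg, Forum Math. Pi 11 (2023) e17, §2.4; Buczyńska–Buczyński, Duke 170 (2021).
-/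


noncomputable section

namespace Summit.MatrixMultiplication.MatrixMultiplication.Theorems.SymbolicSquare

-- single-conjunct summit: the `Summit.<S>.<P>` prefix repeats `MatrixMultiplication` by design (D-0017)
set_option linter.dupNamespace false

open scoped BigOperators Polynomial
open Polynomial

namespace BorelLimit

universe u v

variable {K : Type u} [Field K]

/-! ## Coefficientwise maps on polynomial families -/

section CW

variable {A B B' : Type*} [Semiring A] [Semiring B] [Semiring B'] [Module K A] [Module K B] [Module K B']

/-- `b ↦ b εᵗ` as a `K`-linear map. -/
def monK (t : ℕ) : B →ₗ[K] B[X] where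
  toFun b := monomial t b
  map_add' b b' := by simp
  map_smul' c b := by simp [Polynomial.smul_monomial]

/-- Coefficientwise application of a `K`-linear map `ψ : A → B` to polynomials: `A[ε] → B[ε]`. -/
def cw (ψ : A →ₗ[K] B) : A[X] →ₗ[K] B[X] := Polynomial.lsum (fun t => monK t ∘ₗ ψ)

/-- Coefficients of `cw ψ F`. -/
@[simp] theorem coeff_cw (ψ : A →ₗ[K] B) (F : A[X]) (t : ℕ) : (cw ψ F).coeff t = ψ (F.coeff t) := by
  classical
  simp only [cw, Polynomial.lsum_apply, Polynomial.sum_def, LinearMap.comp_apply, finsetSum_coeff]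
  simp only [monK, LinearMap.coe_mk, AddHom.coe_mk, coeff_monomial]
  rw [Finset.sum_ite_eq']
  split_ifs with h
  · rfl
  · rw [Polynomial.mem_support_iff, not_not] at h
    rw [h, map_zero]

/-- `cw` on constants. -/
theorem cw_C (ψ : A →ₗ[K] B) (a : A) : cw ψ (C a) = C (ψ a) := by
  ext t
  rw [coeff_cw, coeff_C, coeff_C]
  split_ifs <;> simp

/-- `cw` commutes with multiplication by `ε`. -/
theorem cw_X_mul (ψ : A →ₗ[K] B) (F : A[X]) : cw ψ (X * F) = X * cw ψ F := by
  ext t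
  cases t with
  | zero => simp only [coeff_cw, coeff_X_mul_zero, map_zero]
  | succ t => simp only [coeff_cw, coeff_X_mul]

/-- `cw` commutes with multiplication by `ε^k`. -/
theorem cw_X_pow_mul (ψ : A →ₗ[K] B) (k : ℕ) (F : A[X]) : cw ψ (X ^ k * F) = X ^ k * cw ψ F := by
  induction k with
  | zero => simp
  | succ k ih => rw [pow_succ', pow_succ', mul_assoc, cw_X_mul, ih, mul_assoc]

/-- `cw` of a composite. -/
theorem cw_comp (ψ : B →ₗ[K] B') (φ : A →ₗ[K] B) (F : A[X]) : cw (ψ ∘ₗ φ) F = cw ψ (cw φ F) := by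
  ext t
  simp only [coeff_cw, LinearMap.comp_apply]

/-- Coefficients of an iterated coefficientwise endomorphism. -/
theorem coeff_cw_pow (ψ : A →ₗ[K] A) (k : ℕ) (F : A[X]) (t : ℕ) :
    ((cw ψ ^ k) F).coeff t = (ψ ^ k) (F.coeff t) := by
  induction k generalizing F with
  | zero => simp
  | succ k ih => rw [pow_succ, pow_succ, Module.End.mul_apply, Module.End.mul_apply, ih, coeff_cw]

/-- `cw` of a power of an endomorphism. -/
theorem cw_pow (ψ : A →ₗ[K] A) (k : ℕ) (F : A[X]) : cw (ψ ^ k) F = (cw ψ ^ k) F := by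
  ext t
  rw [coeff_cw, coeff_cw_pow]

/-- `cw` commutes with the formal derivative `d/dε`. -/
theorem cw_derivative (ψ : A →ₗ[K] B) (F : A[X]) :
    cw ψ (derivative F) = derivative (cw ψ F) := by
  ext t
  rw [coeff_cw, coeff_derivative, coeff_derivative, coeff_cw]
  rw [← Nat.cast_succ, ← nsmul_eq_mul', map_nsmul, nsmul_eq_mul', Nat.cast_succ]

end CW

section CWAlg

variable {A B : Type*} [Semiring A] [Semiring B] [Algebra K A] [Algebra K B]

/-- `cw` is `K[ε]`-linear: `cw ψ (p(ε) · F) = p(ε) · cw ψ F`. -/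
theorem cw_mapC_mul (ψ : A →ₗ[K] B) (p : K[X]) (F : A[X]) :
    cw ψ (p.map (algebraMap K A) * F) = p.map (algebraMap K B) * cw ψ F := by
  ext t
  simp only [coeff_cw, coeff_mul, coeff_map, map_sum]
  refine Finset.sum_congr rfl fun x _ => ?_
  rw [← Algebra.smul_def, ← Algebra.smul_def, map_smul]

/-- A coefficientwise derivation is a derivation of `A[ε]`. -/
theorem cw_mul_of_leibniz (ψ : A →ₗ[K] A) (hψ : ∀ f g : A, ψ (f * g) = ψ f * g + f * ψ g)
    (F G : A[X]) : cw ψ (F * G) = cw ψ F * G + F * cw ψ G := by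
  ext t
  simp only [coeff_cw, coeff_mul, coeff_add, map_sum, hψ, Finset.sum_add_distrib]

end CWAlg

/-! ## Families with coefficients in a subspace -/

section Fam

variable {σ : Type v}

/-- `S[ε]`: the polynomial families all of whose coefficients lie in the subspace `S`. -/
def famOf (S : Submodule K (MvPolynomial σ K)) : Submodule K (MvPolynomial σ K)[X] where
  carrier := {F | ∀ t, F.coeff t ∈ S}
  add_mem' {F G} hF hG t := by simpa only [coeff_add] using S.add_mem (hF t) (hG t)
  zero_mem' t := by simp
  smul_mem' c F hF t := by simpa only [coeff_smul] using S.smul_mem c (hF t)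

/-- Membership in `S[ε]`. -/
theorem mem_famOf {S : Submodule K (MvPolynomial σ K)} {F : (MvPolynomial σ K)[X]} :
    F ∈ famOf S ↔ ∀ t, F.coeff t ∈ S := Iff.rfl

/-- `S[ε]` is monotone in `S`. -/
theorem famOf_mono {S T : Submodule K (MvPolynomial σ K)} (h : S ≤ T) : famOf S ≤ famOf T :=
  fun _ hF t => h (hF t)

/-- Constant families. -/
theorem C_mem_famOf {S : Submodule K (MvPolynomial σ K)} {w : MvPolynomial σ K} :
    C w ∈ famOf S ↔ w ∈ S := by
  constructor
  · intro h; simpa using h 0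
  · intro h t
    rw [coeff_C]
    split_ifs
    · exact h
    · exact S.zero_mem

/-- `S[ε]` is stable under multiplication by `ε`. -/
theorem X_mul_mem_famOf {S : Submodule K (MvPolynomial σ K)} {F : (MvPolynomial σ K)[X]} :
    X * F ∈ famOf S ↔ F ∈ famOf S := by
  constructor
  · intro h t
    simpa only [coeff_X_mul] using h (t + 1)
  · intro h t
    cases t with
    | zero => simp
    | succ t => simpa only [coeff_X_mul] using h t

/-- `S[ε]` is saturated for powers of `ε`. -/
theorem X_pow_mul_mem_famOf {S : Submodule K (MvPolynomial σ K)} {F : (MvPolynomial σ K)[X]} (k : ℕ) :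
    X ^ k * F ∈ famOf S ↔ F ∈ famOf S := by
  induction k with
  | zero => simp
  | succ k ih => rw [pow_succ', mul_assoc, X_mul_mem_famOf, ih]

/-- `S[ε]` is a `K[ε]`-module. -/
theorem mapC_mul_mem_famOf {S : Submodule K (MvPolynomial σ K)} {F : (MvPolynomial σ K)[X]}
    (p : K[X]) (hF : F ∈ famOf S) : p.map (algebraMap K (MvPolynomial σ K)) * F ∈ famOf S := by
  intro t
  rw [coeff_mul]
  refine S.sum_mem fun x _ => ?_
  rw [coeff_map, ← Algebra.smul_def]
  exact S.smul_mem _ (hF _)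

/-- `S[ε]` is stable under `d/dε`. -/
theorem derivative_mem_famOf {S : Submodule K (MvPolynomial σ K)} {F : (MvPolynomial σ K)[X]}
    (hF : F ∈ famOf S) : derivative F ∈ famOf S := by
  intro t
  rw [coeff_derivative, ← Nat.cast_succ, ← nsmul_eq_mul']
  exact S.nsmul_mem (hF _) _

/-- Products of families: `S₁[ε] · S₂[ε] ⊆ (S₁ S₂)[ε]`. -/
theorem mul_mem_famOf {S₁ S₂ : Submodule K (MvPolynomial σ K)} {F G : (MvPolynomial σ K)[X]}
    (hF : F ∈ famOf S₁) (hG : G ∈ famOf S₂) : F * G ∈ famOf (S₁ * S₂) := by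
  intro t
  rw [coeff_mul]
  exact Submodule.sum_mem _ fun x _ => Submodule.mul_mem_mul (hF _) (hG _)

/-- A coefficientwise map preserving `S` preserves `S[ε]`. -/
theorem cw_mem_famOf {S T : Submodule K (MvPolynomial σ K)} (ψ : MvPolynomial σ K →ₗ[K] MvPolynomial σ K)
    (hψ : ∀ f ∈ S, ψ f ∈ T) {F : (MvPolynomial σ K)[X]} (hF : F ∈ famOf S) : cw ψ F ∈ famOf T :=
  fun t => by simpa only [coeff_cw] using hψ _ (hF t)

/-- **Torsion-freeness of `P[ε]/W[ε]`**: `q(ε) · G ∈ W[ε]` with `q ≠ 0` forces `G ∈ W[ε]` (read a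
linear form killing `W` coefficientwise: `K[ε]` is a domain). -/
theorem mem_famOf_of_mapC_mul_mem {W : Submodule K (MvPolynomial σ K)} {G : (MvPolynomial σ K)[X]}
    {q : K[X]} (hq : q ≠ 0) (h : q.map (algebraMap K (MvPolynomial σ K)) * G ∈ famOf W) :
    G ∈ famOf W := by
  by_contra hG
  rw [mem_famOf] at hG
  push Not at hG
  obtain ⟨t₀, ht₀⟩ := hG
  obtain ⟨φ, hφ, hφW⟩ := Submodule.exists_dual_map_eq_bot_of_notMem ht₀ inferInstance
  have hzero : ∀ w ∈ W, φ w = 0 := fun w hw => by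
    have : φ w ∈ Submodule.map φ W := Submodule.mem_map_of_mem hw
    rwa [hφW, Submodule.mem_bot] at this
  -- apply `φ` coefficientwise
  have h1 : cw φ (q.map (algebraMap K (MvPolynomial σ K)) * G) = 0 := by
    ext t
    rw [coeff_cw, coeff_zero]
    exact hzero _ (h t)
  rw [cw_mapC_mul, Algebra.algebraMap_self, Polynomial.map_id] at h1
  rcases mul_eq_zero.1 h1 with h2 | h2
  · exact hq h2
  · have := congrArg (fun P : K[X] => P.coeff t₀) h2
    simp only [coeff_cw, coeff_zero] at this
    exact hφ this

/-! ## The lattice and the limit -/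

/-- The `t`-th coefficient as a `K`-linear map. -/
def coeffK (t : ℕ) : (MvPolynomial σ K)[X] →ₗ[K] MvPolynomial σ K where
  toFun F := F.coeff t
  map_add' F G := coeff_add F G t
  map_smul' c F := coeff_smul c F t

/-- Unfolding lemma for `coeffK`. -/
@[simp] theorem coeffK_apply (t : ℕ) (F : (MvPolynomial σ K)[X]) : coeffK (K := K) t F = F.coeff t :=
  rfl

variable (Hb : (MvPolynomial σ K)[X] →ₗ[K] (MvPolynomial σ K)[X])

/-- The LATTICE of the translated family `g(1/ε) · W`, tested through the quasi-inverse `Hb`: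
families with coefficients in the ambient piece `S` that `Hb` sends into `W[ε]`. -/
def lat (S W : Submodule K (MvPolynomial σ K)) : Submodule K (MvPolynomial σ K)[X] :=
  famOf S ⊓ (famOf W).comap Hb

/-- Membership in the lattice. -/
theorem mem_lat {S W : Submodule K (MvPolynomial σ K)} {F : (MvPolynomial σ K)[X]} :
    F ∈ lat Hb S W ↔ F ∈ famOf S ∧ Hb F ∈ famOf W := Iff.rfl

/-- The LIMIT subspace `lim_{ε → 0} g(1/ε) · W = {F(0) : F ∈ lat} ≤ S`. -/
def limW (S W : Submodule K (MvPolynomial σ K)) : Submodule K (MvPolynomial σ K) :=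
  (lat Hb S W).map (coeffK 0)

/-- Membership in the limit. -/
theorem mem_limW {S W : Submodule K (MvPolynomial σ K)} {f : MvPolynomial σ K} :
    f ∈ limW Hb S W ↔ ∃ F ∈ lat Hb S W, F.coeff 0 = f := by
  simp [limW]

/-- The constant term of a lattice element lies in the limit. -/
theorem coeff_zero_mem_limW {S W : Submodule K (MvPolynomial σ K)} {F : (MvPolynomial σ K)[X]}
    (hF : F ∈ lat Hb S W) : F.coeff 0 ∈ limW Hb S W :=
  (mem_limW Hb).2 ⟨F, hF, rfl⟩

/-- The limit lies in the ambient piece. -/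
theorem limW_le {S W : Submodule K (MvPolynomial σ K)} : limW Hb S W ≤ S := by
  intro f hf
  obtain ⟨F, hF, rfl⟩ := (mem_limW Hb).1 hf
  exact hF.1 0

/-- The limit is monotone in `W`. -/
theorem limW_mono {S W W' : Submodule K (MvPolynomial σ K)} (h : W ≤ W') :
    limW Hb S W ≤ limW Hb S W' := by
  intro f hf
  obtain ⟨F, hF, rfl⟩ := (mem_limW Hb).1 hf
  exact coeff_zero_mem_limW Hb ⟨hF.1, famOf_mono h hF.2⟩

/-- Sups pass to the limit: `lim W ⊔ lim W' ≤ lim (W ⊔ W')`. -/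
theorem limW_sup_le {S W W' : Submodule K (MvPolynomial σ K)} :
    limW Hb S W ⊔ limW Hb S W' ≤ limW Hb S (W ⊔ W') :=
  sup_le (limW_mono Hb le_sup_left) (limW_mono Hb le_sup_right)

/-- A constant family `w` with `Hb w ∈ W[ε]` contributes `w` to the limit. -/
theorem mem_limW_of_const {S W : Submodule K (MvPolynomial σ K)} {w : MvPolynomial σ K} (hw : w ∈ S)
    (hHb : Hb (C w) ∈ famOf W) : w ∈ limW Hb S W :=
  (mem_limW Hb).2 ⟨C w, ⟨C_mem_famOf.2 hw, hHb⟩, coeff_C_zero⟩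

/-- A subspace `A ≤ S` whose families are `Hb`-stable survives in the limit: `A ≤ lim A`. -/
theorem le_limW_self {S A : Submodule K (MvPolynomial σ K)} (hAS : A ≤ S)
    (hA : ∀ F ∈ famOf A, Hb F ∈ famOf A) : A ≤ limW Hb S A :=
  fun _ hw => mem_limW_of_const Hb (hAS hw) (hA _ (C_mem_famOf.2 hw))

variable (hX : ∀ F, Hb (X * F) = X * Hb F)
include hX

/-- `Hb` commutes with powers of `ε`. -/
theorem map_X_pow_mul (k : ℕ) (F : (MvPolynomial σ K)[X]) : Hb (X ^ k * F) = X ^ k * Hb F := by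
  induction k with
  | zero => simp
  | succ k ih => rw [pow_succ', mul_assoc, hX, ih, mul_assoc]

/-- `Hb` is `K[ε]`-linear. -/
theorem map_mapC_mul (p : K[X]) (F : (MvPolynomial σ K)[X]) :
    Hb (p.map (algebraMap K (MvPolynomial σ K)) * F) = p.map (algebraMap K (MvPolynomial σ K)) * Hb F := by
  induction p using Polynomial.induction_on' with
  | add p q hp hq => rw [Polynomial.map_add, add_mul, map_add, hp, hq, add_mul]
  | monomial n c =>
      have : ∀ G : (MvPolynomial σ K)[X], C ((algebraMap K (MvPolynomial σ K)) c) * G = c • G := by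
        intro G
        rw [← Polynomial.smul_eq_C_mul, algebraMap_smul]
      rw [Polynomial.map_monomial, ← C_mul_X_pow_eq_monomial, mul_assoc, mul_assoc, this, this, map_smul,
        map_X_pow_mul Hb hX]

/-- The lattice is stable under `ε`. -/
theorem X_mul_mem_lat {S W : Submodule K (MvPolynomial σ K)} {F : (MvPolynomial σ K)[X]}
    (hF : F ∈ lat Hb S W) : X * F ∈ lat Hb S W :=
  (mem_lat Hb).2 ⟨X_mul_mem_famOf.2 hF.1, by rw [hX]; exact X_mul_mem_famOf.2 hF.2⟩

/-- The lattice is SATURATED: `ε^k F ∈ lat` with `F ∈ S[ε]`... indeed `F ∈ lat`. -/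
theorem mem_lat_of_X_pow_mul {S W : Submodule K (MvPolynomial σ K)} {F : (MvPolynomial σ K)[X]} (k : ℕ)
    (hF : X ^ k * F ∈ lat Hb S W) : F ∈ lat Hb S W :=
  (mem_lat Hb).2
    ⟨(X_pow_mul_mem_famOf k).1 hF.1, (X_pow_mul_mem_famOf k).1 (by rw [← map_X_pow_mul Hb hX]; exact hF.2)⟩

/-- The lattice is a `K[ε]`-module. -/
theorem mapC_mul_mem_lat {S W : Submodule K (MvPolynomial σ K)} {F : (MvPolynomial σ K)[X]} (p : K[X])
    (hF : F ∈ lat Hb S W) : p.map (algebraMap K (MvPolynomial σ K)) * F ∈ lat Hb S W :=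
  (mem_lat Hb).2 ⟨mapC_mul_mem_famOf p hF.1, by rw [map_mapC_mul Hb hX]; exact mapC_mul_mem_famOf p hF.2⟩

omit hX in
/-- **Products pass to the limit**: if `Hb` is multiplicative up to a power of `ε` on `S₁[ε] × S₂[ε]`
and `S₁ S₂ ≤ S₃`, then `lim I · lim J ≤ lim (I J)`. -/
theorem limW_mul_le {S₁ S₂ S₃ I J : Submodule K (MvPolynomial σ K)} (c : ℕ)
    (hmul : ∀ F ∈ famOf S₁, ∀ G ∈ famOf S₂, Hb F * Hb G = X ^ c * Hb (F * G)) (hS : S₁ * S₂ ≤ S₃) :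
    limW Hb S₁ I * limW Hb S₂ J ≤ limW Hb S₃ (I * J) := by
  rw [Submodule.mul_le]
  intro f hf g hg
  obtain ⟨F, hF, rfl⟩ := (mem_limW Hb).1 hf
  obtain ⟨G, hG, rfl⟩ := (mem_limW Hb).1 hg
  rw [← mul_coeff_zero]
  refine coeff_zero_mem_limW Hb ((mem_lat Hb).2 ⟨famOf_mono hS (mul_mem_famOf hF.1 hG.1), ?_⟩)
  have h := hmul F hF.1 G hG.1
  have h2 : X ^ c * Hb (F * G) ∈ famOf (I * J) := h ▸ mul_mem_famOf hF.2 hG.2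
  exact (X_pow_mul_mem_famOf c).1 h2

omit hX in
/-- **Fixed subspaces survive**: if `A ≤ S` has `Hb`- and `H`-stable families and `H ∘ Hb = ε^a` on
`S[ε]`, then `lim A = A`. -/
theorem limW_eq_self {S A : Submodule K (MvPolynomial σ K)} (hAS : A ≤ S)
    (hA : ∀ F ∈ famOf A, Hb F ∈ famOf A) (H : (MvPolynomial σ K)[X] →ₗ[K] (MvPolynomial σ K)[X])
    (hHA : ∀ F ∈ famOf A, H F ∈ famOf A) (a : ℕ) (hinv : ∀ F ∈ famOf S, H (Hb F) = X ^ a * F) :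
    limW Hb S A = A := by
  refine le_antisymm ?_ (le_limW_self Hb hAS hA)
  intro f hf
  obtain ⟨F, hF, rfl⟩ := (mem_limW Hb).1 hf
  have h1 : X ^ a * F ∈ famOf A := by
    rw [← hinv F hF.1]
    exact hHA _ hF.2
  exact (X_pow_mul_mem_famOf a).1 h1 0

omit hX in
/-- **Inherited stability**: if `ε^k · Hb (E F) = Φ (Hb F)` on `S[ε]` for an operator `Φ` preserving
`W[ε]`, and `E S ⊆ S`, then `lim W` is `E`-stable. -/
theorem limW_stable {S W : Submodule K (MvPolynomial σ K)} (E : MvPolynomial σ K →ₗ[K] MvPolynomial σ K)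
    (hES : ∀ f ∈ S, E f ∈ S) (k : ℕ) (Φ : (MvPolynomial σ K)[X] →ₗ[K] (MvPolynomial σ K)[X])
    (hΦ : ∀ G ∈ famOf W, Φ G ∈ famOf W) (hcomm : ∀ F ∈ famOf S, X ^ k * Hb (cw E F) = Φ (Hb F)) :
    ∀ f ∈ limW Hb S W, E f ∈ limW Hb S W := by
  intro f hf
  obtain ⟨F, hF, rfl⟩ := (mem_limW Hb).1 hf
  have h1 : cw E F ∈ lat Hb S W := by
    refine (mem_lat Hb).2 ⟨cw_mem_famOf E hES hF.1, ?_⟩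
    have h2 : X ^ k * Hb (cw E F) ∈ famOf W := by
      rw [hcomm F hF.1]
      exact hΦ _ hF.2
    exact (X_pow_mul_mem_famOf k).1 h2
  have := coeff_zero_mem_limW Hb h1
  simpa only [coeff_cw] using this

end Fam

end BorelLimit

/-- **Part 1 of `stub_borelNormalForm` (registered helper stub): products of pieces pass to the limit.**
If the quasi-inverse `Hb` of the translate is multiplicative up to `ε^c` on `S₁[ε] × S₂[ε]` and
`S₁ S₂ ≤ S₃`, then `lim I · lim J ≤ lim (I · J)` (the closed condition "`dim (I·J) ≤ const`" survives). -/
theorem stub_borelNormalForm_limits : ∀ {K : Type} [Field K] {σ : Type}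
    (Hb : Polynomial (MvPolynomial σ K) →ₗ[K] Polynomial (MvPolynomial σ K))
    {S₁ S₂ S₃ I J : Submodule K (MvPolynomial σ K)} (c : ℕ),
    (∀ F ∈ BorelLimit.famOf S₁, ∀ G ∈ BorelLimit.famOf S₂, Hb F * Hb G = Polynomial.X ^ c * Hb (F * G)) →
    S₁ * S₂ ≤ S₃ → BorelLimit.limW Hb S₁ I * BorelLimit.limW Hb S₂ J ≤ BorelLimit.limW Hb S₃ (I * J) :=
  fun Hb _ _ _ _ _ c hmul hS => BorelLimit.limW_mul_le Hb c hmul hS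

end Summit.MatrixMultiplication.MatrixMultiplication.Theorems.SymbolicSquare

end
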